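import Mathlib
import Literature.NumberTheory.Automorphic.FundamentalDomainUnfolding

/-!
# Bessel's inequality for automorphic kernels and the local Weyl law for the discrete spectrum
(Iwaniec, *Spectral Methods of Automorphic Forms*, GSM 53, §7.2: (7.8), (7.9), Proposition 7.2
(7.10) and its proof, PDF pp. 71–73)

Fourteenth layer of the `provefact` decomposition of `Literature.NumberTheory.Automorphic.sl2BallCount_asymp`
(`HyperbolicLatticeCount.lean`), fifth brick of the spectral theory of `L²(SL₂(ℤ)\\ℍ)` behind
`Iwaniec2002_thm_7_4_modular` (`ModularPretrace.lean`), whose field `localWeyl` is Proposition 7.2.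
This file proves the *discrete half* of Proposition 7.2 — the bound for `Σ_{|t_j| < T} |u_j(z)|²` —
for every finite orthonormal family of automorphic `C²` eigenfunctions of a discrete `Γ ≤ SL₂(ℝ)`
(`-1 ∈ Γ`, fundamental domain `F`), following the printed proof line by line. (The Eisenstein half,
`∫_{-T}^{T} |E(z, 1/2 + it)|² dt`, needs Proposition 7.1 and is not treated here.) Everything here is
proved; nothing is vendored.

1. `Bessel.sum_norm_sq_integral_le`: Bessel's inequality (7.8) in integral form,
   `Σ_i |∫ v ē_i|² ≤ ∫ |v|²` for a finite orthonormal family in `L²(μ)` (elementary expansion of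
   `‖v - Σ c_i e_i‖² ≥ 0`, as on p. 71).
2. The kernel `k = 𝟙_{[0,δ]}` (`ballKernel`): a test kernel with `∫_0^∞ k = δ`, `h(i/2) = 4πδ`;
   `u(z, w), u(z, w') ≤ δ ⇒ u(w, w') ≤ 4δ(1 + δ)`; `u(i, z) ≤ δ ≤ 1/16 ⇒ |y - 1| ≤ 4√δ`;
   `|y^s - 1| ≤ 4|s|η` for `|y - 1| ≤ η ≤ 1/2`, `|s|η ≤ 1/4`; hence **`|h(t)| ≥ 2πδ`** for
   `s = 1/2 + it`, `|s| ≤ (32√δ)⁻¹`, `δ ≤ 1/64` (the book: `2πδ < |h(t)| < 6πδ` for `|s| ≤ (8√δ)⁻¹`;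
   only the absolute constants differ).
3. `∫_F K(z, w)² dμ(z) ≤ 2 N_δ(w) · 4πδ` (`lintegral_automorphicKernel_sq_le`), `N_δ(w) = #{γ ∈ Γ :
   u(γw, w) ≤ 4δ(δ + 1)}` (`orbitCount`, i.e. `hyperbolicLatticeCount Γ w w (16δ(1+δ)+2)` of
   `HyperbolicLatticeCount.lean`, over matrices), by the unfolding of
   `FundamentalDomainUnfolding.lean`: `∫_F |K(z,w)|² = 2 Σ_γ ∫_ℍ k(u(z, w)) k(u(γz, w)) dμz`, the
   terms with `u(γw, w) > 4δ(δ+1)` vanishing (factor `2`: matrix normalisation).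
4. The projections `∫_F K(z, w) ū(z) dμ(z) = 2 h(t) ū(w)` for automorphic `C²` eigenfunctions with
   real `t` (Theorem 1.16 via `setIntegral_automorphicKernel_mul_eigenfunction`, the conjugate of an
   eigenfunction being one), and **`sum_norm_sq_eigenfunctions_le`**: for `T ≥ 1` and a finite
   orthonormal family `(u_i)` of automorphic `C²` eigenfunctions, `(Δ + 1/4 + t_i²) u_i = 0`, `t_i ∈ ℝ`,
   `|t_i| < T`: `Σ_i |u_i(w)|² ≤ (2048/π) N(w) T²` with `N(w) = N_{1/4096}(w)` — (7.10) for the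
   discrete spectrum, the point dependence kept as the orbit count of the proof (the book continues
   with `N_δ(z) ≪ √δ y_Γ(z) + 1`, Corollary 2.12, which is not needed for `localWeyl`).

Mathlib: `MeasureTheory.MemLp`, `MemLp.integrable_mul` (Cauchy–Schwarz),
`memLp_two_iff_integrable_sq_norm`, `lintegral_tsum`, `Complex.norm_exp_sub_one_le`,
`Real.log_le_sub_one_of_pos`, `InnerProductSpace.laplacian_CLE_comp_left` (for `Δ ū = conj Δ u`).
Literature: layers 11–13 (`invariantOperator`, `selbergTransform_eq_integral`,
`invariantOperator_eigenfunction`, unfolding, `automorphicKernel_comm`). Mathlib's abstract Bessel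
inequality `Orthonormal.sum_inner_products_le` lives on `InnerProductSpace`; the integral form for
a.e.-defined functions is proved directly here rather than through `MeasureTheory.Lp`.
-/

noncomputable section

namespace Literature.NumberTheory.Automorphic

open MeasureTheory Set Filter Real
open scoped Topology ComplexConjugate ENNReal

namespace Bessel

variable {X : Type*} [MeasurableSpace X] {μ : Measure X} {ι : Type*}

/-- Complex conjugation preserves `L²`. [folklore] -/
theorem memLp_conj {g : X → ℂ} (hg : MemLp g 2 μ) : MemLp (fun x => conj (g x)) 2 μ :=
  (Complex.conjCLE.toContinuousLinearMap).comp_memLp' hg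

/-- Products of `L²` functions are integrable (Cauchy–Schwarz). [folklore] -/
theorem integrable_mul {f g : X → ℂ} (hf : MemLp f 2 μ) (hg : MemLp g 2 μ) :
    Integrable (fun x => f x * g x) μ :=
  hf.integrable_mul hg

/-- `v ē` is integrable for `v, e ∈ L²`. [folklore] -/
theorem integrable_mul_conj {f g : X → ℂ} (hf : MemLp f 2 μ) (hg : MemLp g 2 μ) :
    Integrable (fun x => f x * conj (g x)) μ :=
  integrable_mul hf (memLp_conj hg)

/-- `∫ g v̄ = conj ∫ v ḡ`. [folklore] -/
theorem integral_mul_conj_comm (v g : X → ℂ) :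
    ∫ x, g x * conj (v x) ∂μ = conj (∫ x, v x * conj (g x) ∂μ) := by
  rw [← integral_conj]
  congr 1 with x
  simp [mul_comm]

/-- `∫ |v|² = ∫ v v̄` as a complex number. [folklore] -/
theorem integral_norm_sq_eq (v : X → ℂ) :
    ((∫ x, ‖v x‖ ^ 2 ∂μ : ℝ) : ℂ) = ∫ x, v x * conj (v x) ∂μ := by
  rw [← integral_complex_ofReal]
  congr 1 with x
  rw [Complex.mul_conj, Complex.normSq_eq_norm_sq]

/-- **Bessel's inequality, integral form** (Iwaniec (7.8)): for `v ∈ L²(μ)` and a finite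
orthonormal family `(e_i)_{i ∈ s}` in `L²(μ)` (`∫ e_i ē_j = δ_{ij}`),
`Σ_{i ∈ s} |∫ v ē_i|² ≤ ∫ |v|²`. Proof as in the book: `0 ≤ ‖v - Σ_i c_i e_i‖²
= ‖v‖² - Σ_i |c_i|²` with `c_i = ⟨v, e_i⟩`. [cite: Iwaniec2002, (7.8), PDF pp. 71–72] -/
theorem sum_norm_sq_integral_le [DecidableEq ι] (s : Finset ι) {v : X → ℂ} {e : ι → X → ℂ}
    (hv : MemLp v 2 μ) (he : ∀ i ∈ s, MemLp (e i) 2 μ)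
    (horth : ∀ i ∈ s, ∀ j ∈ s, ∫ x, e i x * conj (e j x) ∂μ = if i = j then 1 else 0) :
    ∑ i ∈ s, ‖∫ x, v x * conj (e i x) ∂μ‖ ^ 2 ≤ ∫ x, ‖v x‖ ^ 2 ∂μ := by
  set c : ι → ℂ := fun i => ∫ x, v x * conj (e i x) ∂μ with hc
  set w : X → ℂ := fun x => ∑ i ∈ s, c i * e i x with hw
  set g : X → ℂ := fun x => v x - w x with hg
  have hwL : MemLp w 2 μ := memLp_finsetSum s fun i hi => (he i hi).const_mul (c i)
  have hgL : MemLp g 2 μ := hv.sub hwL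
  -- the key identity: ∫ g ḡ = ∫ v v̄ - Σ |c_i|²
  have hvv := integrable_mul_conj hv hv
  have hvw := integrable_mul_conj hv hwL
  have hwv := integrable_mul_conj hwL hv
  have hww := integrable_mul_conj hwL hwL
  have hsumc : ∑ i ∈ s, (c i * conj (c i)) = ∑ i ∈ s, ((‖c i‖ ^ 2 : ℝ) : ℂ) := by
    refine Finset.sum_congr rfl fun i _ => ?_
    rw [Complex.mul_conj, Complex.normSq_eq_norm_sq]
  -- ∫ v w̄ = Σ conj(c_i) c_i
  have h1 : ∫ x, v x * conj (w x) ∂μ = ∑ i ∈ s, conj (c i) * c i := by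
    simp only [hw, map_sum, Finset.mul_sum, map_mul]
    rw [integral_finsetSum]
    · refine Finset.sum_congr rfl fun i hi => ?_
      have : (fun x => v x * (conj (c i) * conj (e i x))) = fun x => conj (c i) * (v x * conj (e i x)) := by
        funext x; ring
      rw [this, integral_const_mul]
    · intro i hi
      have : (fun x => v x * (conj (c i) * conj (e i x))) = fun x => conj (c i) * (v x * conj (e i x)) := by
        funext x; ring
      rw [this]
      exact (integrable_mul_conj hv (he i hi)).const_mul _
  -- ∫ w v̄ = Σ c_i conj(c_i)
  have h2 : ∫ x, w x * conj (v x) ∂μ = ∑ i ∈ s, c i * conj (c i) := by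
    rw [integral_mul_conj_comm, h1, map_sum]
    refine Finset.sum_congr rfl fun i _ => ?_
    simp [mul_comm]
  -- ∫ w w̄ = Σ_i Σ_j c_i conj(c_j) δ_ij = Σ |c_i|²
  have h3 : ∫ x, w x * conj (w x) ∂μ = ∑ i ∈ s, c i * conj (c i) := by
    have e1 : (fun x => w x * conj (w x)) = fun x => ∑ i ∈ s, ∑ j ∈ s, (c j * conj (c i)) * (e j x * conj (e i x)) := by
      funext x
      simp only [hw, map_sum, map_mul, Finset.sum_mul, Finset.mul_sum]
      refine Finset.sum_congr rfl fun i _ => Finset.sum_congr rfl fun j _ => ?_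
      ring
    rw [e1, integral_finsetSum]
    · refine Finset.sum_congr rfl fun i hi => ?_
      rw [integral_finsetSum]
      · simp_rw [integral_const_mul]
        rw [Finset.sum_eq_single i]
        · rw [horth i hi i hi, if_pos rfl, mul_one]
        · intro j hj hji
          rw [horth j hj i hi, if_neg hji, mul_zero]
        · intro h; exact absurd hi h
      · intro j hj
        exact ((integrable_mul_conj (he j hj) (he i hi)).const_mul _)
    · intro i hi
      refine integrable_finsetSum _ fun j hj => ?_
      exact ((integrable_mul_conj (he j hj) (he i hi)).const_mul _)
  have hkey : ∫ x, g x * conj (g x) ∂μ = (∫ x, v x * conj (v x) ∂μ) - ∑ i ∈ s, c i * conj (c i) := by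
    have e1 : (fun x => g x * conj (g x)) =
        fun x => v x * conj (v x) - v x * conj (w x) - w x * conj (v x) + w x * conj (w x) := by
      funext x; simp only [hg, map_sub]; ring
    rw [e1, integral_add, integral_sub, integral_sub, h1, h2, h3]
    · have : ∑ i ∈ s, conj (c i) * c i = ∑ i ∈ s, c i * conj (c i) :=
        Finset.sum_congr rfl fun i _ => mul_comm _ _
      rw [this]; ring
    · exact hvv
    · exact hvw
    · exact hvv.sub hvw
    · exact hwv
    · exact (hvv.sub hvw).sub hwv
    · exact hww
  -- positivity of ∫ |g|²
  have hpos : 0 ≤ ∫ x, ‖g x‖ ^ 2 ∂μ := integral_nonneg fun x => by positivity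
  have hreal : ((∫ x, ‖g x‖ ^ 2 ∂μ : ℝ) : ℂ) = ((∫ x, ‖v x‖ ^ 2 ∂μ : ℝ) : ℂ) -
      ∑ i ∈ s, ((‖c i‖ ^ 2 : ℝ) : ℂ) := by
    rw [integral_norm_sq_eq, integral_norm_sq_eq, hkey, hsumc]
  have hreal' : ∫ x, ‖g x‖ ^ 2 ∂μ = (∫ x, ‖v x‖ ^ 2 ∂μ) - ∑ i ∈ s, ‖c i‖ ^ 2 := by
    have := hreal
    push_cast at this
    exact_mod_cast this
  linarith

end Bessel

open UpperHalfPlane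
open scoped MatrixGroups

/-! ## A. The kernel of a small hyperbolic disc: `k = 𝟙_{[0, δ]}` -/

section BallKernel

/-- The characteristic function of the segment `0 ≤ u ≤ δ` as a kernel `k(u)` (Iwaniec, proof of
Proposition 7.2: "the kernel `k(u)` which is the characteristic function of the segment
`0 ≤ u ≤ δ`"), extended by the same formula to `u < 0` (irrelevant: `u(z, w) ≥ 0`).
[cite: Iwaniec2002, proof of Prop. 7.2, PDF p. 73] -/
def ballKernel (δ u : ℝ) : ℝ := if u ≤ δ then 1 else 0

variable {δ : ℝ}

/-- `𝟙_{[0,δ]} ≥ 0`. [folklore] -/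
theorem ballKernel_nonneg (δ u : ℝ) : 0 ≤ ballKernel δ u := by
  unfold ballKernel; split_ifs <;> norm_num

/-- `𝟙_{[0,δ]} ≤ 1`. [folklore] -/
theorem ballKernel_le_one (δ u : ℝ) : ballKernel δ u ≤ 1 := by
  unfold ballKernel; split_ifs <;> norm_num

/-- `𝟙_{[0,δ]}(u) = 1` for `u ≤ δ`. [folklore] -/
theorem ballKernel_of_le {u : ℝ} (h : u ≤ δ) : ballKernel δ u = 1 := if_pos h

/-- `𝟙_{[0,δ]}(u) = 0` for `u > δ`. [folklore] -/
theorem ballKernel_of_gt {u : ℝ} (h : δ < u) : ballKernel δ u = 0 := if_neg (not_le.mpr h)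

/-- `𝟙_{[0,δ]}(u) ≠ 0 ↔ u ≤ δ`. [folklore] -/
theorem ballKernel_ne_zero_iff {u : ℝ} : ballKernel δ u ≠ 0 ↔ u ≤ δ := by
  unfold ballKernel; split_ifs with h <;> simp [h]

/-- `𝟙_{[0,δ]}` is measurable. [folklore] -/
theorem measurable_ballKernel (δ : ℝ) : Measurable (ballKernel δ) := by
  unfold ballKernel
  exact Measurable.ite measurableSet_Iic measurable_const measurable_const

/-- `𝟙_{[0,δ]}` is a test kernel ("this is an admissible kernel", p. 73). [cite: Iwaniec2002, proof of Prop. 7.2, PDF p. 73] -/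
theorem isTestKernel_ballKernel (hδ : 0 ≤ δ) : IsTestKernel (ballKernel δ) := by
  refine ⟨measurable_ballKernel δ, ⟨1, fun u => ?_⟩, ⟨δ + 1, by linarith, fun u hu => ballKernel_of_gt (by linarith)⟩⟩
  rw [abs_of_nonneg (ballKernel_nonneg δ u)]
  exact ballKernel_le_one δ u

/-- `∫_0^∞ 𝟙_{[0,δ]} = δ`. [folklore] -/
theorem integral_ballKernel (hδ : 0 ≤ δ) : ∫ u in Ioi 0, ballKernel δ u = δ := by
  have e : EqOn (ballKernel δ) ((Set.Iic δ).indicator fun _ => (1 : ℝ)) (Ioi 0) := by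
    intro u _
    unfold ballKernel
    by_cases h : u ≤ δ
    · rw [if_pos h, Set.indicator_of_mem (show u ∈ Set.Iic δ from h)]
    · rw [if_neg h, Set.indicator_of_notMem (show u ∉ Set.Iic δ from h)]
  rw [setIntegral_congr_fun measurableSet_Ioi e, integral_indicator measurableSet_Iic,
    Measure.restrict_restrict measurableSet_Iic, setIntegral_const]
  rw [show Set.Iic δ ∩ Ioi 0 = Set.Ioc 0 δ by
    ext u; simp only [Set.mem_inter_iff, Set.mem_Iic, Set.mem_Ioi, Set.mem_Ioc]; tauto]
  simp [Real.volume_real_Ioc_of_le hδ]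

/-- `h(i/2) = 4πδ` for `k = 𝟙_{[0,δ]}` ("which is just the hyperbolic area of a disc of radius `r`
given by `sinh(r/2) = √δ`"). [cite: Iwaniec2002, proof of Prop. 7.2, PDF p. 73] -/
theorem selbergTransform_ballKernel_I_half (hδ : 0 ≤ δ) :
    selbergTransform (ballKernel δ) (Complex.I / 2) = ((4 * π * δ : ℝ) : ℂ) := by
  rw [selbergTransform_I_half (isTestKernel_ballKernel hδ), integral_ballKernel hδ]

/-- `∫_ℍ 𝟙_{u(z,w) ≤ δ} dμ(w) = 4πδ`. [cite: Iwaniec2002, proof of Prop. 7.2, PDF p. 73] -/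
theorem integral_ballKernel_pointPairInv (hδ : 0 ≤ δ) (z : ℍ) :
    ∫ w : ℍ, ballKernel δ (pointPairInv z w) = 4 * π * δ := by
  rw [integral_kernel_eq_real (isTestKernel_ballKernel hδ), integral_ballKernel hδ]

end BallKernel

/-! ## B. Two geometric facts -/

section Geometry

/-- If `u(z, w) ≤ δ` and `u(z, w') ≤ δ` then `u(w, w') ≤ 4δ(1 + δ)` ("by the triangle inequality for
the hyperbolic distance", p. 73: `sinh²(2a) = 4 sinh² a cosh² a`). [cite: Iwaniec2002, proof of Prop. 7.2, PDF p. 73] -/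
theorem pointPairInv_le_of_le_of_le {δ : ℝ} (hδ : 0 ≤ δ) {z w w' : ℍ}
    (h1 : pointPairInv z w ≤ δ) (h2 : pointPairInv z w' ≤ δ) :
    pointPairInv w w' ≤ 4 * δ * (1 + δ) := by
  set a : ℝ := Real.arsinh (Real.sqrt δ) with ha
  have hd1 : dist w z ≤ 2 * a := by rw [dist_comm]; exact dist_le_of_pointPairInv_le h1
  have hd2 : dist z w' ≤ 2 * a := dist_le_of_pointPairInv_le h2
  have hd : dist w w' ≤ 2 * (2 * a) := by linarith [dist_triangle w z w']
  have h := pointPairInv_le_of_dist_le hd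
  rw [show 2 * (2 * a) / 2 = 2 * a by ring, Real.sinh_two_mul] at h
  have hs : Real.sinh a = Real.sqrt δ := by rw [ha, Real.sinh_arsinh]
  have hc : Real.cosh a ^ 2 = 1 + δ := by
    rw [Real.cosh_sq', hs, Real.sq_sqrt hδ]
  calc pointPairInv w w' ≤ (2 * Real.sinh a * Real.cosh a) ^ 2 := h
    _ = 4 * Real.sinh a ^ 2 * Real.cosh a ^ 2 := by ring
    _ = 4 * δ * (1 + δ) := by rw [hs, Real.sq_sqrt hδ, hc]

/-- `u(i, z) ≤ δ ≤ 1/16` implies `|Im z - 1| ≤ 4√δ` ("Since `u(i, z) < δ` implies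
`|y - 1| < 4√δ`", p. 73). [cite: Iwaniec2002, proof of Prop. 7.2, PDF p. 73] -/
theorem abs_im_sub_one_le {δ : ℝ} (hδ : 0 ≤ δ) (hδ' : δ ≤ 1 / 16) {z : ℍ}
    (h : pointPairInv UpperHalfPlane.I z ≤ δ) : |z.im - 1| ≤ 4 * Real.sqrt δ := by
  have hy := z.im_pos
  have hu : (z.im - 1) ^ 2 ≤ 4 * δ * z.im := by
    have e := pointPairInv_eq_coord UpperHalfPlane.I z
    rw [UpperHalfPlane.I_re, UpperHalfPlane.I_im] at e
    rw [e] at h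
    rw [div_le_iff₀ (by positivity)] at h
    nlinarith [sq_nonneg (z.re - 0)]
  -- first `Im z ≤ 4`
  have hy4 : z.im ≤ 4 := by
    by_contra hlt
    rw [not_le] at hlt
    nlinarith
  have h16 : (z.im - 1) ^ 2 ≤ 16 * δ := by nlinarith
  have : |z.im - 1| ≤ Real.sqrt (16 * δ) := Real.abs_le_sqrt h16
  rwa [show (16 : ℝ) * δ = 4 ^ 2 * δ by norm_num, Real.sqrt_mul (by norm_num), Real.sqrt_sq (by norm_num)] at this

end Geometry

/-! ## C. `|y^s - 1|` for `y` near `1` -/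

section PowEstimate

/-- `|log y| ≤ 2|y - 1|` for `|y - 1| ≤ 1/2`. [folklore] -/
theorem abs_log_le_two_mul {y : ℝ} (hy : |y - 1| ≤ 1 / 2) : |Real.log y| ≤ 2 * |y - 1| := by
  have hy' : 1 / 2 ≤ y := by linarith [abs_le.mp hy |>.1]
  have hy0 : 0 < y := by linarith
  rw [abs_le]
  constructor
  · -- log y ≥ 1 - 1/y ≥ -2|y-1|
    have h1 : 1 - y⁻¹ ≤ Real.log y := by
      have := Real.log_le_sub_one_of_pos (inv_pos.mpr hy0)
      rw [Real.log_inv] at this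
      linarith
    have h2 : -(2 * |y - 1|) ≤ 1 - y⁻¹ := by
      rw [show 1 - y⁻¹ = (y - 1) / y by field_simp]
      rw [le_div_iff₀ hy0]
      have := neg_abs_le (y - 1)
      nlinarith [abs_nonneg (y - 1)]
    linarith
  · have := Real.log_le_sub_one_of_pos hy0
    linarith [le_abs_self (y - 1), abs_nonneg (y - 1)]

/-- For `y > 0`, `|y - 1| ≤ η ≤ 1/2` and `‖s‖ η ≤ 1/4`: `‖y^s - 1‖ ≤ 4 ‖s‖ η`
(`y^s = e^{s log y}`, `|log y| ≤ 2|y - 1|`, `|e^z - 1| ≤ 2|z|` for `|z| ≤ 1`). [folklore] -/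
theorem norm_cpow_sub_one_le {y η : ℝ} {s : ℂ} (hy : 0 < y) (hη : |y - 1| ≤ η) (hη2 : η ≤ 1 / 2)
    (hs : ‖s‖ * η ≤ 1 / 4) : ‖((y : ℝ) : ℂ) ^ s - 1‖ ≤ 4 * ‖s‖ * η := by
  have hη0 : 0 ≤ η := (abs_nonneg _).trans hη
  have hlog : |Real.log y| ≤ 2 * η := (abs_log_le_two_mul (hη.trans hη2)).trans (by linarith)
  have e : ((y : ℝ) : ℂ) ^ s = Complex.exp (s * Real.log y) := by
    rw [Complex.cpow_def_of_ne_zero (by exact_mod_cast hy.ne'), ← Complex.ofReal_log hy.le, mul_comm]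
  rw [e]
  have hz : ‖s * (Real.log y : ℂ)‖ ≤ 2 * ‖s‖ * η := by
    rw [norm_mul, Complex.norm_real, Real.norm_eq_abs]
    nlinarith [norm_nonneg s]
  have hz1 : ‖s * (Real.log y : ℂ)‖ ≤ 1 := hz.trans (by nlinarith [norm_nonneg s])
  calc ‖Complex.exp (s * Real.log y) - 1‖ ≤ 2 * ‖s * (Real.log y : ℂ)‖ := Complex.norm_exp_sub_one_le hz1
    _ ≤ 2 * (2 * ‖s‖ * η) := by linarith
    _ = 4 * ‖s‖ * η := by ring

end PowEstimate

/-! ## D. Lower bound for `|h(t)|`, `|s| ≤ (32√δ)⁻¹` -/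

section LowerBound

variable {δ : ℝ}

/-- **`|h(t)| ≥ 2πδ` for `k = 𝟙_{[0,δ]}`, `0 < δ ≤ 1/64`, `s = 1/2 + it`, `|s| ≤ (32√δ)⁻¹`** (Iwaniec,
proof of Proposition 7.2: `|h(t) - h(i/2)| ≤ 4|s|√δ h(i/2)` from `|y^s - 1| ≤ ...` on the disc
`u(i, z) ≤ δ`, where `h(i/2) = 4πδ`; "This yields `2πδ < |h(t)| < 6πδ`, if `|s| ≤ (8√δ)⁻¹`" — here
with the absolute constant `32` in place of `8`, immaterial for (7.10)).
[cite: Iwaniec2002, proof of Prop. 7.2, PDF p. 73] -/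
theorem norm_selbergTransform_ballKernel_ge (hδ : 0 < δ) (hδ' : δ ≤ 1 / 64) (t : ℂ)
    (hs : ‖(1 / 2 : ℂ) + Complex.I * t‖ * (32 * Real.sqrt δ) ≤ 1) :
    2 * π * δ ≤ ‖selbergTransform (ballKernel δ) t‖ := by
  set s : ℂ := (1 / 2 : ℂ) + Complex.I * t with hsdef
  have hk := isTestKernel_ballKernel hδ.le
  have hsq : 0 < Real.sqrt δ := Real.sqrt_pos.mpr hδ
  -- h(t) and h(i/2) as integrals over ℍ
  have h1 : selbergTransform (ballKernel δ) t =
      ∫ w : ℍ, (ballKernel δ (pointPairInv UpperHalfPlane.I w) : ℂ) * ((w.im : ℝ) : ℂ) ^ s :=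
    selbergTransform_eq_integral hk t
  have h2 : ∫ w : ℍ, (ballKernel δ (pointPairInv UpperHalfPlane.I w) : ℂ) = ((4 * π * δ : ℝ) : ℂ) := by
    rw [integral_kernel_eq hk UpperHalfPlane.I, integral_ballKernel hδ.le]
  have hint1 : Integrable fun w : ℍ => (ballKernel δ (pointPairInv UpperHalfPlane.I w) : ℂ) * ((w.im : ℝ) : ℂ) ^ s :=
    integrable_kernel_mul_of_continuous hk (continuous_im_cpow s) UpperHalfPlane.I
  have hint2 : Integrable fun w : ℍ => (ballKernel δ (pointPairInv UpperHalfPlane.I w) : ℂ) := by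
    have := integrable_kernel_mul_of_continuous hk (continuous_const (y := (1 : ℂ))) UpperHalfPlane.I
    simpa using this
  -- the difference
  have hdiff : selbergTransform (ballKernel δ) t - ((4 * π * δ : ℝ) : ℂ) =
      ∫ w : ℍ, (ballKernel δ (pointPairInv UpperHalfPlane.I w) : ℂ) * (((w.im : ℝ) : ℂ) ^ s - 1) := by
    rw [h1, ← h2, ← integral_sub hint1 hint2]
    congr 1 with w; ring
  -- pointwise bound on the support
  have hpt : ∀ w : ℍ, ‖(ballKernel δ (pointPairInv UpperHalfPlane.I w) : ℂ) * (((w.im : ℝ) : ℂ) ^ s - 1)‖ ≤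
      (1 / 2) * ballKernel δ (pointPairInv UpperHalfPlane.I w) := by
    intro w
    by_cases hw : pointPairInv UpperHalfPlane.I w ≤ δ
    · rw [ballKernel_of_le hw, norm_mul, Complex.ofReal_one, norm_one, one_mul]
      have hy := abs_im_sub_one_le hδ.le (hδ'.trans (by norm_num)) hw
      have hη2 : 4 * Real.sqrt δ ≤ 1 / 2 := by
        have : Real.sqrt δ ≤ Real.sqrt (1 / 64) := Real.sqrt_le_sqrt hδ'
        rw [show (1 / 64 : ℝ) = (1 / 8) ^ 2 by norm_num, Real.sqrt_sq (by norm_num)] at this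
        linarith
      have hsη : ‖s‖ * (4 * Real.sqrt δ) ≤ 1 / 4 := by nlinarith [norm_nonneg s]
      have := norm_cpow_sub_one_le w.im_pos hy hη2 hsη
      nlinarith [norm_nonneg s]
    · rw [ballKernel_of_gt (not_le.mp hw)]
      simp
  have hbound : ‖selbergTransform (ballKernel δ) t - ((4 * π * δ : ℝ) : ℂ)‖ ≤ 2 * π * δ := by
    rw [hdiff]
    calc ‖∫ w : ℍ, (ballKernel δ (pointPairInv UpperHalfPlane.I w) : ℂ) * (((w.im : ℝ) : ℂ) ^ s - 1)‖
        ≤ ∫ w : ℍ, (1 / 2) * ballKernel δ (pointPairInv UpperHalfPlane.I w) := by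
          refine norm_integral_le_of_norm_le ?_ (Eventually.of_forall hpt)
          have : Integrable fun w : ℍ => ballKernel δ (pointPairInv UpperHalfPlane.I w) := by
            have h3 := hint2.re
            simpa using h3
          exact this.const_mul _
      _ = (1 / 2) * (4 * π * δ) := by rw [integral_const_mul, integral_ballKernel_pointPairInv hδ.le]
      _ = 2 * π * δ := by ring
  -- triangle inequality
  have hmain : ‖((4 * π * δ : ℝ) : ℂ)‖ = 4 * π * δ := by
    rw [Complex.norm_real, Real.norm_eq_abs, abs_of_pos (by positivity)]
  have := norm_sub_norm_le ((4 * π * δ : ℝ) : ℂ) (selbergTransform (ballKernel δ) t)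
  rw [hmain, norm_sub_rev] at this
  linarith

end LowerBound

/-! ## E. `∫_F |K(z, w)|² dμ(z) ≤ 8πδ N_δ(w)` by unfolding -/

section L2Bound

variable {Γ : Subgroup (GL (Fin 2) ℝ)} {F : Set ℍ}
variable (hΓ : Γ ≤ (Matrix.SpecialLinearGroup.toGL : SL(2, ℝ) →* GL (Fin 2) ℝ).range)
  (hneg : (-1 : GL (Fin 2) ℝ) ∈ Γ) (hd : IsDiscreteSubgroup Γ) (hF : IsHypFundamentalDomain Γ F)

/-- The orbit count `N_δ(w) = #{γ ∈ Γ : u(γ w, w) ≤ 4δ(δ + 1)}` of the proof of Proposition 7.2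
(over matrices) — the hyperbolic lattice-point count `P(X)` of `HyperbolicLatticeCount.lean` at
`z = w`, `X = 16δ(1 + δ) + 2` (since `P(X)` counts `4u + 2 ≤ X`); junk value `0` if the set is
infinite, finite for discrete `Γ`. [cite: Iwaniec2002, proof of Prop. 7.2, PDF p. 73] -/
abbrev orbitCount (Γ : Subgroup (GL (Fin 2) ℝ)) (δ : ℝ) (w : ℍ) : ℕ :=
  hyperbolicLatticeCount Γ w w (16 * δ * (1 + δ) + 2)

/-- The set counted by `P(16δ(1+δ) + 2)` at `z = w` is `{γ ∈ Γ : u(γ w, w) ≤ 4δ(1 + δ)}`. [folklore] -/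
theorem orbitCount_set_eq (Γ : Subgroup (GL (Fin 2) ℝ)) (δ : ℝ) (w : ℍ) :
    {γ : GL (Fin 2) ℝ | γ ∈ Γ ∧ 4 * pointPairInv (γ • w) w + 2 ≤ 16 * δ * (1 + δ) + 2} =
      {γ : GL (Fin 2) ℝ | γ ∈ Γ ∧ pointPairInv (γ • w) w ≤ 4 * δ * (1 + δ)} := by
  ext γ
  simp only [Set.mem_setOf_eq]
  constructor <;> rintro ⟨h1, h2⟩ <;> exact ⟨h1, by linarith⟩

/-- `N_δ(w)` as a cardinality of `{γ ∈ Γ : u(γ w, w) ≤ 4δ(1 + δ)}`. [folklore] -/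
theorem orbitCount_eq_ncard (Γ : Subgroup (GL (Fin 2) ℝ)) (δ : ℝ) (w : ℍ) :
    orbitCount Γ δ w = Set.ncard {γ : GL (Fin 2) ℝ | γ ∈ Γ ∧ pointPairInv (γ • w) w ≤ 4 * δ * (1 + δ)} := by
  unfold orbitCount hyperbolicLatticeCount
  rw [orbitCount_set_eq]

include hΓ hd in
/-- The set counted by `N_δ(w)` is finite (discreteness; `finite_hyperbolicLatticeCount_set`). [folklore] -/
theorem finite_orbitCount_set (δ : ℝ) (w : ℍ) :
    {γ : GL (Fin 2) ℝ | γ ∈ Γ ∧ pointPairInv (γ • w) w ≤ 4 * δ * (1 + δ)}.Finite := by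
  rw [← orbitCount_set_eq]
  exact finite_hyperbolicLatticeCount_set hΓ hd w w _

include hΓ hd in
/-- `N_δ(w)` is non-decreasing in `δ ≥ 0` (`hyperbolicLatticeCount_mono`). [folklore] -/
theorem orbitCount_mono {δ δ' : ℝ} (hδ : 0 ≤ δ) (h : δ ≤ δ') (w : ℍ) : orbitCount Γ δ w ≤ orbitCount Γ δ' w :=
  hyperbolicLatticeCount_mono hΓ hd w w (by nlinarith)

include hΓ in
/-- `u(w, γ⁻¹ w) = u(γ w, w)` for `γ ∈ Γ ≤ SL₂(ℝ)`. [folklore] -/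
theorem pointPairInv_inv_smul {γ : GL (Fin 2) ℝ} (hγ : γ ∈ Γ) (w : ℍ) :
    pointPairInv w (γ⁻¹ • w) = pointPairInv (γ • w) w := by
  rw [pointPairInv_smul_right (hΓ (Γ.inv_mem hγ)), inv_inv]

variable {δ : ℝ}

/-- Measurability of `z ↦ u(z, w)`. [folklore] -/
theorem measurable_pointPairInv_left (w : ℍ) : Measurable fun z : ℍ => pointPairInv z w := by
  have h := (continuous_pointPairInv w).measurable
  have e : (fun z : ℍ => pointPairInv w z) = fun z => pointPairInv z w := funext fun z => pointPairInv_comm w z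
  rwa [e] at h

/-- Measurability in `z` of `𝟙_{u(γz, w) ≤ δ}`. [folklore] -/
theorem measurable_ballKernel_smul (γ : GL (Fin 2) ℝ) (w : ℍ) :
    Measurable fun z : ℍ => ballKernel δ (pointPairInv (γ • z) w) :=
  (measurable_ballKernel δ).comp ((measurable_pointPairInv_left w).comp (measurable_const_smul γ))

include hΓ hd in
/-- The automorphic kernel of `𝟙_{[0,δ]}` in `ℝ≥0∞`: `ofReal K(z, w) = Σ_γ ofReal 𝟙(u(γz, w) ≤ δ)`.
[folklore] -/
theorem ofReal_automorphicKernel_ballKernel (z w : ℍ) :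
    ENNReal.ofReal (automorphicKernel Γ (ballKernel δ) z w) =
      ∑' γ : Γ, ENNReal.ofReal (ballKernel δ (pointPairInv ((γ : GL (Fin 2) ℝ) • z) w)) := by
  have hM : ∀ u, δ + 1 ≤ u → ballKernel δ u = 0 := fun u hu => ballKernel_of_gt (by linarith)
  rw [← tsum_kernel_eq_automorphicKernel hΓ hd hM z w]
  refine ENNReal.ofReal_tsum_of_nonneg (fun γ => ballKernel_nonneg δ _) ?_
  -- finitely supported, hence summable
  have hfin := finite_hypBall hΓ hd z w (δ + 1)
  refine summable_of_hasFiniteSupport ?_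
  refine (hfin.preimage (Subtype.val_injective.injOn)).subset ?_
  intro γ hγ
  simp only [Function.mem_support, ne_eq] at hγ
  simp only [Set.mem_preimage, Set.mem_setOf_eq]
  refine ⟨γ.2, ?_⟩
  by_contra hlt
  exact hγ (hM _ (not_le.mp hlt).le)

include hΓ hd in
/-- `z ↦ K(z, w)` is measurable (in `ℝ≥0∞`). [folklore] -/
theorem measurable_ofReal_automorphicKernel_ballKernel (w : ℍ) :
    Measurable fun z : ℍ => ENNReal.ofReal (automorphicKernel Γ (ballKernel δ) z w) := by
  haveI : Countable Γ := hd.countable.to_subtype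
  have e : (fun z : ℍ => ENNReal.ofReal (automorphicKernel Γ (ballKernel δ) z w)) = fun z =>
      ∑' γ : Γ, ENNReal.ofReal (ballKernel δ (pointPairInv ((γ : GL (Fin 2) ℝ) • z) w)) :=
    funext fun z => ofReal_automorphicKernel_ballKernel hΓ hd z w
  rw [e]
  exact Measurable.tsum fun γ => ENNReal.measurable_ofReal.comp (measurable_ballKernel_smul _ w)

include hΓ hd in
/-- `K(z, w) ≥ 0` for the kernel `𝟙_{[0,δ]}`. [folklore] -/
theorem automorphicKernel_ballKernel_nonneg (z w : ℍ) : 0 ≤ automorphicKernel Γ (ballKernel δ) z w := by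
  have hM : ∀ u, δ + 1 ≤ u → ballKernel δ u = 0 := fun u hu => ballKernel_of_gt (by linarith)
  rw [← tsum_kernel_eq_automorphicKernel hΓ hd hM z w]
  exact tsum_nonneg fun γ => ballKernel_nonneg δ _

include hΓ hd in
/-- Measurability of `z ↦ K(z, w)` (as a real function). [folklore] -/
theorem measurable_automorphicKernel_ballKernel (w : ℍ) :
    Measurable fun z : ℍ => automorphicKernel Γ (ballKernel δ) z w := by
  have h := (measurable_ofReal_automorphicKernel_ballKernel hΓ hd (δ := δ) w).ennreal_toReal
  have e : (fun z : ℍ => (ENNReal.ofReal (automorphicKernel Γ (ballKernel δ) z w)).toReal) =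
      fun z => automorphicKernel Γ (ballKernel δ) z w :=
    funext fun z => ENNReal.toReal_ofReal (automorphicKernel_ballKernel_nonneg hΓ hd z w)
  rwa [e] at h

include hΓ hneg hd hF in
/-- **`∫_F K(z, w)² dμ(z) ≤ 2 N_δ(w) · 4πδ`** for `k = 𝟙_{[0,δ]}` (Iwaniec, proof of Prop. 7.2:
`∫_F |K(z,w)|² dμz = Σ_γ ∫_ℍ k(z, w) k(z, γw) dμz ≤ N_δ(w) h(i/2)` by unfolding, the terms with
`u(w, γw) > 4δ(δ+1)` vanishing by the triangle inequality; the factor `2` from the matrix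
normalisation). Lebesgue-integral form. [cite: Iwaniec2002, proof of Prop. 7.2, PDF p. 73] -/
theorem lintegral_automorphicKernel_sq_le (hδ : 0 ≤ δ) (w : ℍ) :
    ∫⁻ z in F, ENNReal.ofReal ((automorphicKernel Γ (ballKernel δ) z w) ^ 2) ≤
      2 * (orbitCount Γ δ w : ℝ≥0∞) * ENNReal.ofReal (4 * π * δ) := by
  haveI : Countable Γ := hd.countable.to_subtype
  have hM : ∀ u, δ + 1 ≤ u → ballKernel δ u = 0 := fun u hu => ballKernel_of_gt (by linarith)
  set K : ℍ → ℝ := fun z => automorphicKernel Γ (ballKernel δ) z w with hK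
  have hK0 : ∀ z, 0 ≤ K z := fun z => automorphicKernel_ballKernel_nonneg hΓ hd z w
  -- φ(z) = k(u(z,w)) K(z,w) in ℝ≥0∞
  set φ : ℍ → ℝ≥0∞ := fun z => ENNReal.ofReal (ballKernel δ (pointPairInv z w)) * ENNReal.ofReal (K z) with hφ
  have hφm : Measurable φ :=
    Measurable.mul (ENNReal.measurable_ofReal.comp ((measurable_ballKernel δ).comp (measurable_pointPairInv_left w)))
      (measurable_ofReal_automorphicKernel_ballKernel hΓ hd w)
  -- Σ_γ' φ(γ' z) = ofReal (K z ^ 2)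
  have hsum : ∀ z, ∑' γ : Γ, φ ((γ : GL (Fin 2) ℝ) • z) = ENNReal.ofReal (K z ^ 2) := by
    intro z
    have e : ∀ γ : Γ, automorphicKernel Γ (ballKernel δ) ((γ : GL (Fin 2) ℝ) • z) w =
        automorphicKernel Γ (ballKernel δ) z w := fun γ => automorphicKernel_smul_left hΓ hd hM γ.2 z w
    simp only [hφ, hK, e]
    rw [ENNReal.tsum_mul_right, ← ofReal_automorphicKernel_ballKernel hΓ hd z w,
      ← ENNReal.ofReal_mul (hK0 z), sq]
  -- unfold
  have h1 := setLIntegral_tsum_smul_eq hΓ hneg hd.countable hF hφm.aemeasurable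
  simp_rw [hsum] at h1
  rw [h1]
  -- ∫ φ = Σ_γ ∫ k(u(z,w)) k(u(γ z, w))
  have h2 : ∫⁻ z, φ z = ∑' γ : Γ, ∫⁻ z, ENNReal.ofReal (ballKernel δ (pointPairInv z w)) *
      ENNReal.ofReal (ballKernel δ (pointPairInv ((γ : GL (Fin 2) ℝ) • z) w)) := by
    simp only [hφ, hK]
    simp_rw [ofReal_automorphicKernel_ballKernel hΓ hd _ w, ← ENNReal.tsum_mul_left]
    rw [lintegral_tsum]
    intro γ
    exact (Measurable.mul (ENNReal.measurable_ofReal.comp ((measurable_ballKernel δ).comp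
      (measurable_pointPairInv_left w))) (ENNReal.measurable_ofReal.comp (measurable_ballKernel_smul _ w))).aemeasurable
  rw [h2]
  -- each term is ≤ 4πδ and vanishes unless u(γ w, w) ≤ 4δ(1+δ)
  set S : Set (GL (Fin 2) ℝ) := {γ : GL (Fin 2) ℝ | γ ∈ Γ ∧ pointPairInv (γ • w) w ≤ 4 * δ * (1 + δ)} with hS
  have hSfin : S.Finite := finite_orbitCount_set hΓ hd δ w
  classical
  set T : Finset Γ := hSfin.toFinset.subtype (· ∈ Γ) with hT
  have hTcard : T.card = orbitCount Γ δ w := by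
    rw [orbitCount_eq_ncard, Set.ncard_eq_toFinset_card _ hSfin, hT, Finset.card_subtype]
    congr 1
    apply Finset.filter_true_of_mem
    intro γ hγ
    exact ((Set.Finite.mem_toFinset hSfin).mp hγ).1
  have hterm : ∀ γ : Γ, ∫⁻ z, ENNReal.ofReal (ballKernel δ (pointPairInv z w)) *
      ENNReal.ofReal (ballKernel δ (pointPairInv ((γ : GL (Fin 2) ℝ) • z) w)) ≤
      if γ ∈ T then ENNReal.ofReal (4 * π * δ) else 0 := by
    intro γ
    by_cases hγ : γ ∈ T
    · rw [if_pos hγ]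
      calc ∫⁻ z, ENNReal.ofReal (ballKernel δ (pointPairInv z w)) *
            ENNReal.ofReal (ballKernel δ (pointPairInv ((γ : GL (Fin 2) ℝ) • z) w))
          ≤ ∫⁻ z, ENNReal.ofReal (ballKernel δ (pointPairInv z w)) := by
            refine lintegral_mono fun z => ?_
            calc _ ≤ ENNReal.ofReal (ballKernel δ (pointPairInv z w)) * 1 := by
                  gcongr
                  rw [← ENNReal.ofReal_one]
                  exact ENNReal.ofReal_le_ofReal (ballKernel_le_one δ _)
              _ = _ := mul_one _
        _ = ENNReal.ofReal (∫ z, ballKernel δ (pointPairInv z w)) := by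
            rw [ofReal_integral_eq_lintegral_ofReal]
            · have hk := isTestKernel_ballKernel hδ
              have h := integrable_kernel_mul_of_continuous hk (continuous_const (y := (1 : ℂ))) w
              have h3 : Integrable fun z : ℍ => ballKernel δ (pointPairInv w z) := by
                have h4 := h.re
                refine h4.congr (Eventually.of_forall fun z => ?_)
                simp
              exact h3.congr (Eventually.of_forall fun z => by simp [pointPairInv_comm])
            · exact Eventually.of_forall fun z => ballKernel_nonneg δ _
        _ = ENNReal.ofReal (4 * π * δ) := by
            congr 1
            have := integral_ballKernel_pointPairInv hδ w
            simp_rw [pointPairInv_comm w] at this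
            exact this
    · rw [if_neg hγ]
      refine le_of_eq ?_
      have hzero : (fun z : ℍ => ENNReal.ofReal (ballKernel δ (pointPairInv z w)) *
          ENNReal.ofReal (ballKernel δ (pointPairInv ((γ : GL (Fin 2) ℝ) • z) w))) = fun _ => 0 := by
        funext z
        by_contra hne
        have h1 : ballKernel δ (pointPairInv z w) ≠ 0 := by
          intro h; apply hne; simp [h]
        have h2 : ballKernel δ (pointPairInv ((γ : GL (Fin 2) ℝ) • z) w) ≠ 0 := by
          intro h; apply hne; simp [h]
        rw [ballKernel_ne_zero_iff] at h1 h2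
        have e : pointPairInv ((γ : GL (Fin 2) ℝ) • z) w = pointPairInv z ((γ : GL (Fin 2) ℝ)⁻¹ • w) := by
          rw [pointPairInv_smul_right (hΓ (Γ.inv_mem γ.2)), inv_inv]
        rw [e] at h2
        have h3 := pointPairInv_le_of_le_of_le hδ (z := z) (w := w) (w' := (γ : GL (Fin 2) ℝ)⁻¹ • w) h1 h2
        rw [pointPairInv_inv_smul hΓ γ.2] at h3
        apply hγ
        rw [hT, Finset.mem_subtype, Set.Finite.mem_toFinset]
        exact ⟨γ.2, h3⟩
      rw [hzero, lintegral_zero]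
  calc 2 * ∑' γ : Γ, ∫⁻ z, ENNReal.ofReal (ballKernel δ (pointPairInv z w)) *
          ENNReal.ofReal (ballKernel δ (pointPairInv ((γ : GL (Fin 2) ℝ) • z) w))
      ≤ 2 * ∑' γ : Γ, (if γ ∈ T then ENNReal.ofReal (4 * π * δ) else 0) :=
        mul_le_mul_right (ENNReal.tsum_le_tsum hterm) 2
    _ = 2 * (orbitCount Γ δ w : ℝ≥0∞) * ENNReal.ofReal (4 * π * δ) := by
        rw [tsum_eq_sum (s := T) (fun γ hγ => if_neg hγ), Finset.sum_ite_mem, Finset.inter_self,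
          Finset.sum_const, hTcard, nsmul_eq_mul]
        ring

end L2Bound

/-! ## F. Conjugates of eigenfunctions and the projections `⟨K(·, w), u⟩ = 2 h(t) ū(w)` -/

section Projection

variable {Γ : Subgroup (GL (Fin 2) ℝ)} {F : Set ℍ} {k : ℝ → ℝ} {f : ℍ → ℂ}

/-- The conjugate of an automorphic function is automorphic. [folklore] -/
theorem IsAutomorphic.conj (hf : IsAutomorphic Γ f) : IsAutomorphic Γ (fun z => conj (f z)) :=
  fun γ hγ z => by simp only [hf γ hγ z]

/-- The conjugate of a `C²` function is `C²`. [folklore] -/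
theorem IsC2.conj (hf : IsC2 f) : IsC2 (fun z => conj (f z)) := by
  have e : ((fun z => conj (f z)) ∘ ofComplex : ℂ → ℂ) = (Complex.conjCLE : ℂ ≃L[ℝ] ℂ) ∘ (f ∘ ofComplex) := by
    funext p; rfl
  unfold IsC2
  rw [e]
  exact (Complex.conjCLE : ℂ ≃L[ℝ] ℂ).comp_contDiffOn_iff.mpr hf

/-- `Δ f̄ = conj (Δ f)` (the Laplacian has real coefficients). [folklore] -/
theorem hypLaplacian_conj (f : ℍ → ℂ) (z : ℍ) :
    hypLaplacian (fun z => conj (f z)) z = conj (hypLaplacian f z) := by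
  unfold hypLaplacian
  have e : ((fun z => conj (f z)) ∘ ofComplex : ℂ → ℂ) = (Complex.conjCLE : ℂ ≃L[ℝ] ℂ) ∘ (f ∘ ofComplex) := by
    funext p; rfl
  rw [e, InnerProductSpace.laplacian_CLE_comp_left]
  simp only [Function.comp_apply, Complex.conjCLE_apply, map_mul, map_pow, Complex.conj_ofReal]

/-- The conjugate of an eigenfunction with real spectral parameter `t` is an eigenfunction with the
same eigenvalue `1/4 + t²`. [folklore] -/
theorem eigen_conj (t : ℝ) (heig : ∀ z, hypLaplacian f z + (1 / 4 + (t : ℂ) ^ 2) * f z = 0) (z : ℍ) :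
    hypLaplacian (fun z => conj (f z)) z + (1 / 4 + (t : ℂ) ^ 2) * conj (f z) = 0 := by
  rw [hypLaplacian_conj]
  have h := congrArg conj (heig z)
  simp only [map_add, map_mul, map_zero, map_pow, Complex.conj_ofReal, map_div₀, map_one] at h
  convert h using 2
  norm_num [map_ofNat]

variable (hΓ : Γ ≤ (Matrix.SpecialLinearGroup.toGL : SL(2, ℝ) →* GL (Fin 2) ℝ).range)
  (hneg : (-1 : GL (Fin 2) ℝ) ∈ Γ) (hd : IsDiscreteSubgroup Γ) (hF : IsHypFundamentalDomain Γ F)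
include hΓ hneg hd hF

/-- **The projection of the automorphic kernel on an eigenfunction** (Iwaniec, proof of Thm 7.4 and
of (7.9): `⟨f, u_j⟩ = ∫_F K(z, w) ū_j(z) dμz = h(t_j) ū_j(w)` "by Theorem 1.16"), here for an
automorphic `C²` eigenfunction `u` with real spectral parameter `t`, `(Δ + 1/4 + t²) u = 0`, a test
kernel `k` and its automorphic kernel `K` over matrices:
`∫_F K(z, w) ū(z) dμ(z) = 2 h(t) ū(w)`. [cite: Iwaniec2002, §7.2 (proof of (7.9)) & §7.4, PDF pp. 72, 76] -/
theorem setIntegral_automorphicKernel_mul_conj (hk : IsTestKernel k) {u : ℍ → ℂ}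
    (hua : IsAutomorphic Γ u) (huc : IsC2 u) (t : ℝ)
    (heig : ∀ z, hypLaplacian u z + (1 / 4 + (t : ℂ) ^ 2) * u z = 0) (w : ℍ) :
    ∫ z in F, (automorphicKernel Γ k z w : ℂ) * conj (u z) = 2 * selbergTransform k t * conj (u w) := by
  obtain ⟨hkm, hB, ⟨M, hM0, hM⟩⟩ := id hk
  have h := setIntegral_automorphicKernel_mul_eigenfunction hΓ hneg hd hF hk hua.conj huc.conj (t : ℂ)
    (eigen_conj t heig) w
  rw [← h]
  refine setIntegral_congr_fun hF.measurableSet fun z _ => ?_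
  rw [automorphicKernel_comm hΓ hd hM z w]

end Projection

/-! ## G. The local Weyl law for the discrete spectrum (Proposition 7.2, discrete part) -/

section LocalWeyl

variable {Γ : Subgroup (GL (Fin 2) ℝ)} {F : Set ℍ}
variable (hΓ : Γ ≤ (Matrix.SpecialLinearGroup.toGL : SL(2, ℝ) →* GL (Fin 2) ℝ).range)
  (hneg : (-1 : GL (Fin 2) ℝ) ∈ Γ) (hd : IsDiscreteSubgroup Γ) (hF : IsHypFundamentalDomain Γ F)
include hΓ hneg hd hF

/-- `K(·, w) ∈ L²(F)` for the kernel `𝟙_{[0,δ]}`, with `∫_F K(z,w)² dμ(z) ≤ 2 N_δ(w) 4πδ`. [cite: Iwaniec2002, proof of Prop. 7.2, PDF p. 73] -/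
theorem memLp_automorphicKernel_ballKernel {δ : ℝ} (hδ : 0 ≤ δ) (w : ℍ) :
    MemLp (fun z : ℍ => (automorphicKernel Γ (ballKernel δ) z w : ℂ)) 2 (volume.restrict F) ∧
      ∫ z in F, ‖(automorphicKernel Γ (ballKernel δ) z w : ℂ)‖ ^ 2 ≤ 2 * orbitCount Γ δ w * (4 * π * δ) := by
  set K : ℍ → ℝ := fun z => automorphicKernel Γ (ballKernel δ) z w with hK
  have hKm : Measurable K := measurable_automorphicKernel_ballKernel hΓ hd w
  have hK0 : ∀ z, 0 ≤ K z := fun z => automorphicKernel_ballKernel_nonneg hΓ hd z w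
  have hbound := lintegral_automorphicKernel_sq_le hΓ hneg hd hF hδ w
  have hmeas : AEStronglyMeasurable (fun z => (K z : ℂ)) (volume.restrict F) :=
    (Complex.measurable_ofReal.comp hKm).aestronglyMeasurable
  have enorm_eq : ∀ z, ‖(‖(K z : ℂ)‖ ^ 2 : ℝ)‖ₑ = ENNReal.ofReal (K z ^ 2) := by
    intro z
    rw [Complex.norm_real, Real.norm_eq_abs, abs_of_nonneg (hK0 z), Real.enorm_eq_ofReal (sq_nonneg _)]
  have hfin : ∫⁻ z in F, ‖(‖(K z : ℂ)‖ ^ 2 : ℝ)‖ₑ < ∞ := by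
    simp_rw [enorm_eq]
    refine lt_of_le_of_lt hbound ?_
    exact ENNReal.mul_lt_top (ENNReal.mul_lt_top (by norm_num) (by simp)) ENNReal.ofReal_lt_top
  have hint : Integrable (fun z => ‖(K z : ℂ)‖ ^ 2) (volume.restrict F) :=
    ⟨(hmeas.norm.pow 2), hfin⟩
  have hL2 : MemLp (fun z : ℍ => (K z : ℂ)) 2 (volume.restrict F) :=
    (memLp_two_iff_integrable_sq_norm hmeas).mpr hint
  refine ⟨hL2, ?_⟩
  rw [integral_eq_lintegral_of_nonneg_ae (Eventually.of_forall fun z => by positivity) hint.aestronglyMeasurable]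
  have e2 : ∫⁻ z in F, ENNReal.ofReal (‖(K z : ℂ)‖ ^ 2) = ∫⁻ z in F, ENNReal.ofReal (K z ^ 2) := by
    congr 1 with z
    rw [Complex.norm_real, Real.norm_eq_abs, abs_of_nonneg (hK0 z)]
  rw [e2]
  have htop : 2 * (orbitCount Γ δ w : ℝ≥0∞) * ENNReal.ofReal (4 * π * δ) ≠ ∞ :=
    ENNReal.mul_ne_top (ENNReal.mul_ne_top (by norm_num) (by simp)) ENNReal.ofReal_ne_top
  have := ENNReal.toReal_mono htop hbound
  refine this.trans (le_of_eq ?_)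
  rw [ENNReal.toReal_mul, ENNReal.toReal_mul, ENNReal.toReal_ofReal (by positivity)]
  simp

/-- **Proposition 7.2, discrete part (local Weyl law for Maass forms)**: let `Γ ≤ SL₂(ℝ)` be discrete
with `-1 ∈ Γ` and fundamental domain `F`, and let `(u_i)_{i ∈ s}` be a finite family of automorphic
`C²` eigenfunctions, `(Δ + 1/4 + t_i²) u_i = 0` with `t_i ∈ ℝ`, orthonormal in `L²(F)`. Then for
`T ≥ 1` and all `|t_i| < T`:
`Σ_i |u_i(w)|² ≤ (2048/π) N(w) T²`, `N(w) = #{γ ∈ Γ : u(γw, w) ≤ 4δ₀(1 + δ₀)}`, `δ₀ = 1/4096`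
(Iwaniec (7.10): `Σ_{|t_j| < T} |u_j(z)|² + ... ≪ T² + T y_Γ(z)`; here the dependence on the point is
kept as the orbit count `N(w)` of the proof, p. 73, and the absolute constants differ). Proof as
printed: Bessel's inequality (7.8)–(7.9) for `K(·, w)`, `k = 𝟙_{[0,δ]}`, `δ = (64T)⁻²`, the projections
`2h(t_i) ū_i(w)` (Theorem 1.16), `|h(t_i)| ≥ 2πδ`, and `∫_F |K|² ≤ 8πδ N_δ(w)` by unfolding.
[cite: Iwaniec2002, Prop. 7.2 (7.10) & its proof (7.8)–(7.9), PDF pp. 71–73] -/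
theorem sum_norm_sq_eigenfunctions_le {ι : Type*} [DecidableEq ι] (s : Finset ι) (u : ι → ℍ → ℂ) (t : ι → ℝ)
    (hua : ∀ i ∈ s, IsAutomorphic Γ (u i)) (huc : ∀ i ∈ s, IsC2 (u i))
    (heig : ∀ i ∈ s, ∀ z, hypLaplacian (u i) z + (1 / 4 + (t i : ℂ) ^ 2) * u i z = 0)
    (hL2 : ∀ i ∈ s, MemLp (u i) 2 (volume.restrict F))
    (horth : ∀ i ∈ s, ∀ j ∈ s, ∫ z in F, u i z * conj (u j z) = if i = j then 1 else 0)
    {T : ℝ} (hT : 1 ≤ T) (ht : ∀ i ∈ s, |t i| < T) (w : ℍ) :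
    ∑ i ∈ s, ‖u i w‖ ^ 2 ≤ (2048 / π) * orbitCount Γ (1 / 4096) w * T ^ 2 := by
  -- the parameter δ = (64 T)⁻²
  set δ : ℝ := ((64 * T) ^ 2)⁻¹ with hδdef
  have hT0 : 0 < T := by linarith
  have hδ : 0 < δ := by rw [hδdef]; positivity
  have hδ' : δ ≤ 1 / 4096 := by
    rw [hδdef, inv_le_comm₀ (by positivity) (by norm_num)]
    nlinarith
  have hsq : Real.sqrt δ = (64 * T)⁻¹ := by
    rw [hδdef, Real.sqrt_inv, Real.sqrt_sq (by positivity)]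
  -- the kernel and its automorphic kernel
  have hk := isTestKernel_ballKernel hδ.le
  set K : ℍ → ℝ := fun z => automorphicKernel Γ (ballKernel δ) z w with hK
  obtain ⟨hKL2, hKint⟩ := memLp_automorphicKernel_ballKernel hΓ hneg hd hF hδ.le w
  -- Bessel
  have hB := Bessel.sum_norm_sq_integral_le (μ := volume.restrict F) s hKL2 hL2 horth
  -- the projections and the lower bound for h
  have hproj : ∀ i ∈ s, ∫ z in F, (K z : ℂ) * conj (u i z) = 2 * selbergTransform (ballKernel δ) (t i) * conj (u i w) :=
    fun i hi => setIntegral_automorphicKernel_mul_conj hΓ hneg hd hF hk (hua i hi) (huc i hi) (t i) (heig i hi) w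
  have hh : ∀ i ∈ s, 2 * π * δ ≤ ‖selbergTransform (ballKernel δ) (t i)‖ := by
    intro i hi
    refine norm_selbergTransform_ballKernel_ge hδ (hδ'.trans (by norm_num)) (t i) ?_
    have hs : ‖(1 / 2 : ℂ) + Complex.I * (t i : ℂ)‖ ≤ 1 / 2 + |t i| := by
      calc ‖(1 / 2 : ℂ) + Complex.I * (t i : ℂ)‖ ≤ ‖(1 / 2 : ℂ)‖ + ‖Complex.I * (t i : ℂ)‖ := norm_add_le _ _
        _ = 1 / 2 + |t i| := by
            rw [norm_mul, Complex.norm_I, one_mul, Complex.norm_real, Real.norm_eq_abs]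
            norm_num
    rw [hsq]
    have : (1 / 2 + |t i|) * (32 * (64 * T)⁻¹) ≤ 1 := by
      rw [show (32 : ℝ) * (64 * T)⁻¹ = (2 * T)⁻¹ by field_simp; ring]
      rw [mul_inv_le_iff₀ (by positivity)]
      linarith [ht i hi]
    exact le_trans (mul_le_mul_of_nonneg_right hs (by positivity)) this
  -- lower bound of each Bessel coefficient
  have hcoef : ∀ i ∈ s, (4 * π * δ) ^ 2 * ‖u i w‖ ^ 2 ≤ ‖∫ z in F, (K z : ℂ) * conj (u i z)‖ ^ 2 := by
    intro i hi
    rw [hproj i hi, norm_mul, norm_mul, Complex.norm_two, Complex.norm_conj, ← mul_pow]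
    apply pow_le_pow_left₀ (by positivity)
    have := hh i hi
    nlinarith [norm_nonneg (u i w), norm_nonneg (selbergTransform (ballKernel δ) (t i))]
  -- combine
  have hsum : (4 * π * δ) ^ 2 * ∑ i ∈ s, ‖u i w‖ ^ 2 ≤ 2 * orbitCount Γ δ w * (4 * π * δ) := by
    rw [Finset.mul_sum]
    exact (Finset.sum_le_sum hcoef).trans (hB.trans hKint)
  have hN : (orbitCount Γ δ w : ℝ) ≤ orbitCount Γ (1 / 4096) w := by
    exact_mod_cast orbitCount_mono hΓ hd hδ.le hδ' w
  have hπ := Real.pi_pos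
  -- Σ ≤ 2 N (4πδ) / (4πδ)² = N / (2πδ) = (2048/π) N T²
  have hδT : δ⁻¹ = 4096 * T ^ 2 := by rw [hδdef, inv_inv]; ring
  have key : ∑ i ∈ s, ‖u i w‖ ^ 2 ≤ 2 * orbitCount Γ δ w * (4 * π * δ) / (4 * π * δ) ^ 2 := by
    rw [le_div_iff₀ (by positivity)]
    linarith
  calc ∑ i ∈ s, ‖u i w‖ ^ 2 ≤ 2 * orbitCount Γ δ w * (4 * π * δ) / (4 * π * δ) ^ 2 := key
    _ = (2048 / π) * orbitCount Γ δ w * T ^ 2 := by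
        field_simp
        rw [show δ = (4096 * T ^ 2)⁻¹ by rw [← hδT, inv_inv]]
        field_simp
        ring
    _ ≤ (2048 / π) * orbitCount Γ (1 / 4096) w * T ^ 2 := by
        gcongr

end LocalWeyl

end Literature.NumberTheory.Automorphic
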